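import Summits.QuantumFields.BalabanUV.T4Continuum.Support.ShellMeasureAverageAnalytic

/-!
# `T4Continuum.ShellMeasureAverageAnalyticB7` — WALL §3 W-d, ANALYTIC HALF (instance): THE PRINTED BLOCK AVERAGE
# (2.4)∕[B7] (15) IN THE CHART, `B12AverageCorridor267.Qtilde L 𝒯 V`, read per coarse bond `c` on the bond variables
# of `B(c₋) ∪ B(c₊)`, IS ANALYTIC ON AN EXPLICIT SUP-BALL, VANISHES AT `0`, AND IS BOUNDED — radius and bound in
# `(L, d)` ONLY, uniformly in the background `V` subject to the loop-level small field `ε ≤ 1∕8`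
(cell `pub-balaban`, sub-cell `t4`, spine estimate NE7c (node U5b), owner lineage `b2b-balaban-t4-ne7c-p1` gen 28, table
`LEAVES-NE7c-P1.md` row S49 file 2; imports file 1 `ShellMeasureAverageAnalytic` ONLY; [folklore]; 0 `def`, 0 sorry)

HONEST FRAMING.  Finite four-torus programme, rung (B)+1 only — NOT infinite volume, NOT a mass gap, NOT the Clay
problem, NOT summit progress; (B), `BetaPertHyp`, (B^μ) are not consumed.  NE7c (`T4IndicatorShell.ShellWeightBound`)
is NOT PRINTED and NOT PROVED; «NE7c ⇐ the named binders».  What is proved here is an elementary property of the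
PRINTED averaging operation [Balaban1985Averaging] (15) (= [Balaban1987RG1] (0.12) with the contours of
[Balaban1984PropagatorsI] (1.7)) as DEFINED in the tree (`B12AverageCorridor267.Qtilde`, `avgM`, `loopW`, `pert`,
`B12HOperator267.gammaT`) — nothing printed is asserted; the papers treat this analyticity as evident («we make a change
of variables linearizing the function Q̃(B′) … it is an analytic function of B», p. 267) and display no radius.  HONEST
DEPENDENCY (cell): continuum YM on T⁴ ⇐ BetaPertH ∧ nine spine estimates (0/9 proved); BetaPertH ⇐ (D1) ∧ (D4) ∧
CAP+tail; G-an2-4 gates asym, D1 and NE2/3/4.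

WHAT IS PROVED (the items recorded «Fréchet differentiability of (2.4) in B′ … NOT proved» in `B12AverageCorridor267`'s
typing (c), and «NOT CLAIMED: that Bałaban's averaging-in-the-chart Q̃ satisfies the four hypotheses with k-UNIFORM
R, M_Q» in `Beta/LinearizingChange267FromQ` (row D4) — the first three of the four; the fourth, `h` a right inverse of
`DQ̃(0)`, is row S48).  The chart variable is READ PER COARSE BOND: `E_c := ↥(qppBonds L c) → 𝔸` (sup norm) — the bond
functions on `B(c₋) ∪ B(c₊)`, extended by `0` (`Function.extend Subtype.val B 0`); by block locality
(`B12AverageCorridor267.Qtilde_congr`) nothing is lost (`Qtilde_eq_extend_restrict`).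
* §1 the extension by zero; §2 every transporter of the average is an `ExpWord` (file 1) of the perturbed
  configuration `pert (ext B) V`: one bond — weight `1`; `lineR … n` — weight `n`; `Ustr` — weight `L`; the printed
  contours `gammaT` — weight `d·L`; the loop `W_x = loopW` — weight `2w_𝒯 + 2L` for ANY transporter family whose
  transporters are `ExpWord`s of weight `w_𝒯` (`= d·L` for `gammaT`).
* §3 at `B = 0` the perturbed configuration is `V` and the average is `avgM L 𝒯 V c`; `Qtilde` IS file 1's chart
  average with `S(B) = Σ_{x∈B(c₋)} L⁻ᵈ • mlog W_x(B)`, `T(B) = Ustr L (pert (ext B) V) c` (`Qtilde_extend_eq`).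
* §4 **`analyticOnNhd_Qtilde`**, **`Qtilde_zero`**, **`norm_Qtilde_le`** — for ANY block-local family `𝒯` with
  `ExpWord` transporters of weight `w_𝒯`, unit-bounded `V` (`‖V b‖, ‖V b⁻¹‖ ≤ 1`) and block loops with
  `‖W_x(V) − 1‖ ≤ ε ≤ 1∕8` on `B(c₋)`: with `w := 2w_𝒯 + 2L` and **`R := 1∕(1408·w)`**, the map
  `B ↦ Q̃_V(ext B)(c)` is `AnalyticOnNhd ℂ` on `ball 0 R`, `Q̃_V(0)(c) = 0`, and `‖Q̃_V(ext B)(c)‖ ≤ 1408·w·‖B‖ ≤ 1`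
  there (radii `R₀ = 1∕w`, `R₁ = 1∕(32w)` of file 1; numerics `e < 2.72`).
* §5 THE PRINTED INSTANCE [B7] (15): `𝒯 = gammaT` (`isBlockLocal_gammaT`, axis loops `≡ 1` by `loopW_axisSite`):
  **`analyticOnNhd_Qtilde_gammaT`**, **`norm_Qtilde_gammaT_le`** with **`R = 1∕(2816·(d+1)·L)`**, hypotheses EXACTLY
  those of `h_paragraph_p267_gammaT` (`hW` on the off-axis loops, `hV`, `hV'`, `0 ≤ ε ≤ 1∕8`); `Qtilde_eq_extend_restrict`.
NOT HERE: `fderiv = LQ` and `h` (row S48); reality (row S47); the junction (row S46); torus∕centred-cube geometry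
(the b12 lineage's DIVERGENCE D-b12g20.1 is inherited: corner cubes on `ℤᵈ`).
-/

noncomputable section

open NormedSpace Metric Set Finset

namespace Summit.QuantumFields.BalabanUV.T4Continuum.ShellMeasureAverageAnalyticB7

open Literature.MathematicalPhysics.QuantumFieldTheory.Balaban1983to89
open Literature.MathematicalPhysics.QuantumLattice (ZdEdge blockMap blockBase blockSites mem_blockSites_iff
  card_blockSites)
open B7BlockGeometry (qppBonds)
open B7Eq61Linearization (pathProd lineR)
open B12HOperator267 (gammaT gammaPt axisSite)
open B12AverageCorridor267 (expU pert pert_apply pert_zero Ustr loopW loopW_def avgM Qtilde Qtilde_congr IsBlockLocal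
  loopW_axisSite axisSites offAxis isBlockLocal_gammaT isAxisStraightFamily_gammaT)
open MatrixLog (mlog mlog_one)
open ShellMeasureAverageAnalytic

variable {d : ℕ} {𝔸 : Type*} [NormedRing 𝔸] [NormedAlgebra ℂ 𝔸] [CompleteSpace 𝔸] [NormOneClass 𝔸]
variable {L : ℕ} {c : ZdEdge d} {V : ZdEdge d → 𝔸ˣ}

/-! ## §1 The chart variable per coarse bond: bond functions on `B(c₋) ∪ B(c₊)`, extended by zero -/

omit [NormedAlgebra ℂ 𝔸] [CompleteSpace 𝔸] [NormOneClass 𝔸] in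
/-- The extension by zero restricts back to the given values. [folklore] -/
theorem extend_val (B : ↥(qppBonds L c) → 𝔸) (b : ↥(qppBonds L c)) :
    Function.extend Subtype.val B (0 : ZdEdge d → 𝔸) (b : ZdEdge d) = B b :=
  Subtype.val_injective.extend_apply _ _ _

omit [NormedAlgebra ℂ 𝔸] [CompleteSpace 𝔸] [NormOneClass 𝔸] in
/-- … and vanishes off `B(c₋) ∪ B(c₊)`. [folklore] -/
theorem extend_of_not_mem (B : ↥(qppBonds L c) → 𝔸) {b : ZdEdge d} (hb : b ∉ qppBonds L c) :
    Function.extend Subtype.val B (0 : ZdEdge d → 𝔸) b = 0 := by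
  rw [Function.extend_apply' _ _ _ fun ⟨a, ha⟩ => hb (ha ▸ a.2), Pi.zero_apply]

omit [NormedAlgebra ℂ 𝔸] [CompleteSpace 𝔸] [NormOneClass 𝔸] in
/-- The extension of `0` is `0`. [folklore] -/
theorem extend_zero : Function.extend Subtype.val (0 : ↥(qppBonds L c) → 𝔸) (0 : ZdEdge d → 𝔸) = 0 := by
  funext b
  by_cases hb : b ∈ qppBonds L c
  · exact extend_val (0 : ↥(qppBonds L c) → 𝔸) ⟨b, hb⟩
  · exact extend_of_not_mem _ hb

omit [NormedAlgebra ℂ 𝔸] [CompleteSpace 𝔸] [NormOneClass 𝔸] in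
/-- Extending the restriction of a configuration reproduces it on `B(c₋) ∪ B(c₊)`. [folklore] -/
theorem extend_restrict (B' : ZdEdge d → 𝔸) {b : ZdEdge d} (hb : b ∈ qppBonds L c) :
    Function.extend Subtype.val (fun i : ↥(qppBonds L c) => B' i) (0 : ZdEdge d → 𝔸) b = B' b :=
  extend_val (fun i : ↥(qppBonds L c) => B' i) ⟨b, hb⟩

omit [NormOneClass 𝔸] in
/-- At `B = 0` the perturbed configuration is the background. [folklore] -/
theorem pert_extend_zero (V : ZdEdge d → 𝔸ˣ) :
    pert (Function.extend Subtype.val (0 : ↥(qppBonds L c) → 𝔸) (0 : ZdEdge d → 𝔸)) V = V := by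
  rw [extend_zero, pert_zero]

/-! ## §2 The transporters of the average are `ExpWord`s of the perturbed configuration -/

/-- ONE BOND: `B ↦ e^{iB(b)}V(b)` (`B(b) := 0` off the two blocks) is an `ExpWord` of weight `1`. [folklore] -/
theorem expWord_pert (hV : ∀ b, ‖((V b : 𝔸ˣ) : 𝔸)‖ ≤ 1) (hV' : ∀ b, ‖(((V b)⁻¹ : 𝔸ˣ) : 𝔸)‖ ≤ 1) (b : ZdEdge d) :
    ExpWord (fun B : ↥(qppBonds L c) → 𝔸 => pert (Function.extend Subtype.val B (0 : ZdEdge d → 𝔸)) V b) 1 := by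
  by_cases hb : b ∈ qppBonds L c
  · have h : (fun B : ↥(qppBonds L c) → 𝔸 => pert (Function.extend Subtype.val B (0 : ZdEdge d → 𝔸)) V b)
        = fun B => expU (Complex.I • (ContinuousLinearMap.proj (R := ℂ) (φ := fun _ : ↥(qppBonds L c) => 𝔸)
            ⟨b, hb⟩) B) * V b := by
      funext B
      rw [pert_apply, ContinuousLinearMap.proj_apply, ← extend_val B ⟨b, hb⟩]
    rw [h]
    exact ExpWord.expFactor _ (fun B => norm_le_pi_norm B ⟨b, hb⟩) (hV b) (hV' b)
  · have h : (fun B : ↥(qppBonds L c) → 𝔸 => pert (Function.extend Subtype.val B (0 : ZdEdge d → 𝔸)) V b)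
        = fun _ => V b := by
      funext B
      rw [pert_apply, extend_of_not_mem B hb, smul_zero, B12AverageCorridor267.expU_zero, one_mul]
    rw [h]
    exact (ExpWord.const (hV b) (hV' b)).mono zero_le_one

/-- A STRAIGHT SEGMENT of `n` bonds (`B7Eq61Linearization.lineR`): weight `n`. [folklore] -/
theorem expWord_lineR (hV : ∀ b, ‖((V b : 𝔸ˣ) : 𝔸)‖ ≤ 1) (hV' : ∀ b, ‖(((V b)⁻¹ : 𝔸ˣ) : 𝔸)‖ ≤ 1)
    (x : Fin d → ℤ) (μ : Fin d) (n : ℕ) :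
    ExpWord (fun B : ↥(qppBonds L c) → 𝔸 =>
      lineR (pert (Function.extend Subtype.val B (0 : ZdEdge d → 𝔸)) V) x μ n) n := by
  have h := ExpWord.pathProd (E := ↥(qppBonds L c) → 𝔸)
    (G := fun B t => pert (Function.extend Subtype.val B (0 : ZdEdge d → 𝔸)) V (x + Pi.single μ (t : ℤ), μ))
    (w := 1) (fun t => expWord_pert hV hV' _) n
  rw [mul_one] at h
  exact h

/-- THE COARSE-BOND HOLONOMY `U(c′)` (`Ustr`, `L` bonds): weight `L`. [folklore] -/
theorem expWord_Ustr (hV : ∀ b, ‖((V b : 𝔸ˣ) : 𝔸)‖ ≤ 1) (hV' : ∀ b, ‖(((V b)⁻¹ : 𝔸ˣ) : 𝔸)‖ ≤ 1) (c' : ZdEdge d) :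
    ExpWord (fun B : ↥(qppBonds L c) → 𝔸 => Ustr L (pert (Function.extend Subtype.val B (0 : ZdEdge d → 𝔸)) V) c')
      L :=
  expWord_lineR hV hV' _ _ L

/-- THE PRINTED CONTOURS `Γ_{y,x}` of [Balaban1984PropagatorsI] (1.7) (`B12HOperator267.gammaT`: `d` straight pieces of
`< L` bonds each): weight `d·L`. [folklore] -/
theorem expWord_gammaT (hL : 0 < L) (hV : ∀ b, ‖((V b : 𝔸ˣ) : 𝔸)‖ ≤ 1) (hV' : ∀ b, ‖(((V b)⁻¹ : 𝔸ˣ) : 𝔸)‖ ≤ 1)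
    (x : Fin d → ℤ) :
    ExpWord (fun B : ↥(qppBonds L c) → 𝔸 => gammaT L (pert (Function.extend Subtype.val B (0 : ZdEdge d → 𝔸)) V) x)
      (d * L) := by
  have hpiece : ∀ i ∈ (List.finRange d).reverse, ExpWord (fun B : ↥(qppBonds L c) → 𝔸 =>
      lineR (pert (Function.extend Subtype.val B (0 : ZdEdge d → 𝔸)) V) (gammaPt (blockBase L (blockMap L x)) x i) i
        (x i - blockBase L (blockMap L x) i).toNat) ((fun _ => (L : ℝ)) i) := by
    intro i _
    refine (expWord_lineR hV hV' _ _ _).mono ?_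
    have hL' : (0 : ℤ) < L := by exact_mod_cast hL
    have hmod : x i - blockBase L (blockMap L x) i = x i % (L : ℤ) := by
      simp only [blockBase, blockMap]; rw [Int.emod_def]
    have h0 : 0 ≤ x i - blockBase L (blockMap L x) i := by rw [hmod]; exact Int.emod_nonneg _ hL'.ne'
    have h1 : x i - blockBase L (blockMap L x) i < L := by rw [hmod]; exact Int.emod_lt_of_pos _ hL'
    have : ((x i - blockBase L (blockMap L x) i).toNat : ℝ) ≤ L := by
      have h2 : ((x i - blockBase L (blockMap L x) i).toNat : ℤ) ≤ L := by
        rw [Int.toNat_of_nonneg h0]; exact h1.le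
      exact_mod_cast h2
    exact this
  have h := ExpWord.listProd (E := ↥(qppBonds L c) → 𝔸)
    (fun i B => lineR (pert (Function.extend Subtype.val B (0 : ZdEdge d → 𝔸)) V)
      (gammaPt (blockBase L (blockMap L x)) x i) i (x i - blockBase L (blockMap L x) i).toNat)
    (fun _ => (L : ℝ)) (List.finRange d).reverse hpiece
  have hsum : (((List.finRange d).reverse).map fun _ : Fin d => (L : ℝ)).sum = d * L := by
    rw [List.map_const', List.sum_replicate, List.length_reverse, List.length_finRange, nsmul_eq_mul]
  rw [hsum] at h
  exact h

variable {𝒯 : (ZdEdge d → 𝔸ˣ) → (Fin d → ℤ) → 𝔸ˣ} {w𝒯 : ℝ}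

/-- THE LOOP `W_x = 𝒯(x)·U([x,x′])·𝒯(x′)⁻¹·U(c)⁻¹` (`loopW`): weight `2w_𝒯 + 2L`. [folklore] -/
theorem expWord_loopW (hV : ∀ b, ‖((V b : 𝔸ˣ) : 𝔸)‖ ≤ 1) (hV' : ∀ b, ‖(((V b)⁻¹ : 𝔸ˣ) : 𝔸)‖ ≤ 1)
    (h𝒯 : ∀ x, ExpWord (fun B : ↥(qppBonds L c) → 𝔸 =>
      𝒯 (pert (Function.extend Subtype.val B (0 : ZdEdge d → 𝔸)) V) x) w𝒯) (x : Fin d → ℤ) :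
    ExpWord (fun B : ↥(qppBonds L c) → 𝔸 =>
      loopW L 𝒯 (pert (Function.extend Subtype.val B (0 : ZdEdge d → 𝔸)) V) c x) (2 * w𝒯 + 2 * L) := by
  have h := (((h𝒯 x).mul (expWord_lineR hV hV' x c.2 L)).mul (h𝒯 (x + Pi.single c.2 (L : ℤ))).inv).mul
    (expWord_Ustr hV hV' c).inv
  exact h.mono (le_of_eq (by ring))


/-! ## §3 `Qtilde` IS file 1's chart average (exponent `S`, transporter `T`) -/

/-- The numerics of the radii: with `w ≥ 2`, `0 ≤ w_T`, `2w_T ≤ w`, `ε ≤ 1∕8` and `R₀ = 1∕w`, `R₁ = 1∕(32w)`,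
`R = 1∕(1408w)`: file 1's two smallness conditions hold and its constant is `≤ 1408w` (`e < 2.72`). [folklore] -/
theorem radii_numerics {w wT ε : ℝ} (hw : 2 ≤ w) (hwT' : 2 * wT ≤ w) (hε : ε ≤ 1 / 8) :
    ε + (Real.exp (w * (1 / w)) + 1) / (1 / w) * (1 / (32 * w)) ≤ 1 / 2 ∧
    (Real.exp (2 + wT * (1 / (32 * w))) + 1) / (1 / (32 * w)) * (1 / (1408 * w)) ≤ 1 / 2 ∧
    2 * ((Real.exp (2 + wT * (1 / (32 * w))) + 1) / (1 / (32 * w))) ≤ 1408 * w := by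
  have hw0 : 0 < w := by linarith
  have he1 : Real.exp 1 < 2.7182818286 := Real.exp_one_lt_d9
  have he0 : 0 < Real.exp 1 := Real.exp_pos 1
  have hexp1 : Real.exp (w * (1 / w)) = Real.exp 1 := by rw [mul_one_div_cancel hw0.ne']
  have ht : wT * (1 / (32 * w)) ≤ 1 := by
    rw [mul_one_div, div_le_one (by positivity)]; nlinarith
  have hexp3 : Real.exp (2 + wT * (1 / (32 * w))) ≤ 21 := by
    calc Real.exp (2 + wT * (1 / (32 * w))) ≤ Real.exp ((3 : ℕ) * 1) :=
          Real.exp_le_exp.2 (by push_cast; linarith)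
      _ = Real.exp 1 ^ 3 := Real.exp_nat_mul 1 3
      _ ≤ 21 := by nlinarith [mul_pos he0 he0]
  refine ⟨?_, ?_, ?_⟩
  · rw [hexp1]
    have : (Real.exp 1 + 1) / (1 / w) * (1 / (32 * w)) = (Real.exp 1 + 1) / 32 := by
      field_simp
    rw [this]; linarith
  · have : (Real.exp (2 + wT * (1 / (32 * w))) + 1) / (1 / (32 * w)) * (1 / (1408 * w))
        = (Real.exp (2 + wT * (1 / (32 * w))) + 1) / 44 := by
      field_simp; ring
    rw [this]; linarith
  · have : 2 * ((Real.exp (2 + wT * (1 / (32 * w))) + 1) / (1 / (32 * w)))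
        = 64 * w * (Real.exp (2 + wT * (1 / (32 * w))) + 1) := by
      field_simp; ring
    rw [this]; nlinarith

omit [NormOneClass 𝔸] in
/-- The weights of the exponent sum to one: `Σ_{x∈B(c₋)} ‖(Lᵈ)⁻¹‖ = Lᵈ·L⁻ᵈ ≤ 1`. [folklore] -/
theorem sum_norm_weights_le_one (hL : 0 < L) (y : Fin d → ℤ) :
    ∑ _x ∈ blockSites L y, ‖(((L : ℂ) ^ d)⁻¹ : ℂ)‖ ≤ 1 := by
  have hLd : (0 : ℝ) < (L : ℝ) ^ d := by positivity
  rw [sum_const, card_blockSites, nsmul_eq_mul, norm_inv, norm_pow, Complex.norm_natCast]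
  push_cast
  rw [mul_inv_cancel₀ hLd.ne']

omit [NormOneClass 𝔸] in
/-- **`Qtilde` IS THE CHART AVERAGE OF FILE 1**: for the chart variable `B` on `B(c₋) ∪ B(c₊)`,
`Q̃_V(ext B)(c) = (−i)·log(e^{S(B)}·T(B)·(e^{S(0)}·T(0))⁻¹)` with `S(B) = Σ_x L⁻ᵈ•log W_x(pert (ext B) V)` and
`T(B) = Ustr L (pert (ext B) V) c` (at `B = 0` these are `avgM L 𝒯 V c`'s exponent and transporter). [folklore] -/
theorem Qtilde_extend_eq (V : ZdEdge d → 𝔸ˣ) (B : ↥(qppBonds L c) → 𝔸) :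
    Qtilde L 𝒯 V (Function.extend Subtype.val B (0 : ZdEdge d → 𝔸)) c
      = (-Complex.I) • mlog (((expU ((fun B : ↥(qppBonds L c) → 𝔸 => ∑ x ∈ blockSites L c.1, (((L : ℂ) ^ d)⁻¹ : ℂ) •
            mlog ((loopW L 𝒯 (pert (Function.extend Subtype.val B (0 : ZdEdge d → 𝔸)) V) c x : 𝔸ˣ) : 𝔸)) B) *
          (fun B : ↥(qppBonds L c) → 𝔸 => Ustr L (pert (Function.extend Subtype.val B (0 : ZdEdge d → 𝔸)) V) c) B) *
          (expU ((fun B : ↥(qppBonds L c) → 𝔸 => ∑ x ∈ blockSites L c.1, (((L : ℂ) ^ d)⁻¹ : ℂ) •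
            mlog ((loopW L 𝒯 (pert (Function.extend Subtype.val B (0 : ZdEdge d → 𝔸)) V) c x : 𝔸ˣ) : 𝔸)) 0) *
          (fun B : ↥(qppBonds L c) → 𝔸 => Ustr L (pert (Function.extend Subtype.val B (0 : ZdEdge d → 𝔸)) V) c)
            0)⁻¹ : 𝔸ˣ) : 𝔸) := by
  simp only [pert_extend_zero]
  rfl

/-! ## §4 The three analytic facts for a block-local transporter family -/

section Family

variable (hL : 0 < L) (hV : ∀ b, ‖((V b : 𝔸ˣ) : 𝔸)‖ ≤ 1) (hV' : ∀ b, ‖(((V b)⁻¹ : 𝔸ˣ) : 𝔸)‖ ≤ 1)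
  (hw𝒯 : 0 ≤ w𝒯)
  (h𝒯 : ∀ x, ExpWord (fun B : ↥(qppBonds L c) → 𝔸 =>
    𝒯 (pert (Function.extend Subtype.val B (0 : ZdEdge d → 𝔸)) V) x) w𝒯)
  {ε : ℝ} (hε : ε ≤ 1 / 8)
  (hW : ∀ x ∈ blockSites L c.1, ‖((loopW L 𝒯 V c x : 𝔸ˣ) : 𝔸) - 1‖ ≤ ε)
include hL hV hV' hw𝒯 h𝒯 hε hW

/-- The exponent `S` is analytic on `‖B‖ < 1∕(32w)` and bounded by `1` there, `w = 2w_𝒯 + 2L`. [folklore] -/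
theorem exponent_analytic_and_bounded (B : ↥(qppBonds L c) → 𝔸) (hB : ‖B‖ < 1 / (32 * (2 * w𝒯 + 2 * L))) :
    AnalyticAt ℂ (fun B : ↥(qppBonds L c) → 𝔸 => ∑ x ∈ blockSites L c.1, (((L : ℂ) ^ d)⁻¹ : ℂ) •
        mlog ((loopW L 𝒯 (pert (Function.extend Subtype.val B (0 : ZdEdge d → 𝔸)) V) c x : 𝔸ˣ) : 𝔸)) B ∧
      ‖∑ x ∈ blockSites L c.1, (((L : ℂ) ^ d)⁻¹ : ℂ) •
        mlog ((loopW L 𝒯 (pert (Function.extend Subtype.val B (0 : ZdEdge d → 𝔸)) V) c x : 𝔸ˣ) : 𝔸)‖ ≤ 1 := by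
  have hLr : (1 : ℝ) ≤ L := by exact_mod_cast hL
  have hw : 2 ≤ 2 * w𝒯 + 2 * L := by linarith
  have hw0 : 0 < 2 * w𝒯 + 2 * L := by linarith
  obtain ⟨hq, -, -⟩ := radii_numerics (wT := L) hw (by linarith) hε
  have hR₀ : (0 : ℝ) < 1 / (2 * w𝒯 + 2 * L) := by positivity
  have hR₁ : 1 / (32 * (2 * w𝒯 + 2 * L)) ≤ 1 / (2 * w𝒯 + 2 * L) :=
    one_div_le_one_div_of_le hw0 (by linarith)
  have hloops := fun x (_ : x ∈ blockSites L c.1) => expWord_loopW (c := c) hV hV' h𝒯 x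
  have hε' : ∀ x ∈ blockSites L c.1, ‖(((fun B : ↥(qppBonds L c) → 𝔸 =>
      loopW L 𝒯 (pert (Function.extend Subtype.val B (0 : ZdEdge d → 𝔸)) V) c x) 0 : 𝔸ˣ) : 𝔸) - 1‖ ≤ ε :=
    fun x hx => by simp only [pert_extend_zero]; exact hW x hx
  exact ⟨analyticAt_exponent hloops hR₀ hR₁ hε' hq hB,
    norm_exponent_le hloops hR₀ hR₁ hε' hq (sum_norm_weights_le_one hL c.1) hB⟩

/-- **THE AVERAGE IN THE CHART IS ANALYTIC** on `ball 0 (1∕(1408·(2w_𝒯 + 2L)))`. [folklore] -/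
theorem analyticOnNhd_Qtilde :
    AnalyticOnNhd ℂ (fun B : ↥(qppBonds L c) → 𝔸 => Qtilde L 𝒯 V (Function.extend Subtype.val B (0 : ZdEdge d → 𝔸)) c)
      (ball 0 (1 / (1408 * (2 * w𝒯 + 2 * L)))) := by
  have hLr : (1 : ℝ) ≤ L := by exact_mod_cast hL
  have hw : 2 ≤ 2 * w𝒯 + 2 * L := by linarith
  have hw0 : 0 < 2 * w𝒯 + 2 * L := by linarith
  obtain ⟨-, hK, -⟩ := radii_numerics (wT := L) hw (by linarith) hε
  have hR₁ : (0 : ℝ) < 1 / (32 * (2 * w𝒯 + 2 * L)) := by positivity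
  have hR : 1 / (1408 * (2 * w𝒯 + 2 * L)) ≤ 1 / (32 * (2 * w𝒯 + 2 * L)) :=
    one_div_le_one_div_of_le (by positivity) (by linarith)
  have key : (fun B : ↥(qppBonds L c) → 𝔸 => Qtilde L 𝒯 V (Function.extend Subtype.val B (0 : ZdEdge d → 𝔸)) c) = _ :=
    funext fun B => Qtilde_extend_eq (L := L) (𝒯 := 𝒯) (c := c) V B
  rw [key]
  exact chartAverage_analyticOnNhd (expWord_Ustr hV hV' c) hR₁
    (fun B hB => (exponent_analytic_and_bounded hL hV hV' hw𝒯 h𝒯 hε hW B hB).1)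
    (fun B hB => (exponent_analytic_and_bounded hL hV hV' hw𝒯 h𝒯 hε hW B hB).2) hR hK

/-- **THE AVERAGE IN THE CHART IS BOUNDED, LINEARLY**: `‖Q̃_V(ext B)(c)‖ ≤ 1408·(2w_𝒯 + 2L)·‖B‖` on the ball —
in particular `≤ 1` there. [folklore] -/
theorem norm_Qtilde_le {B : ↥(qppBonds L c) → 𝔸} (hB : ‖B‖ < 1 / (1408 * (2 * w𝒯 + 2 * L))) :
    ‖Qtilde L 𝒯 V (Function.extend Subtype.val B (0 : ZdEdge d → 𝔸)) c‖ ≤ 1408 * (2 * w𝒯 + 2 * L) * ‖B‖ := by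
  have hLr : (1 : ℝ) ≤ L := by exact_mod_cast hL
  have hw : 2 ≤ 2 * w𝒯 + 2 * L := by linarith
  have hw0 : 0 < 2 * w𝒯 + 2 * L := by linarith
  obtain ⟨-, hK, hC⟩ := radii_numerics (wT := L) hw (by linarith) hε
  have hR₁ : (0 : ℝ) < 1 / (32 * (2 * w𝒯 + 2 * L)) := by positivity
  have hR : 1 / (1408 * (2 * w𝒯 + 2 * L)) ≤ 1 / (32 * (2 * w𝒯 + 2 * L)) :=
    one_div_le_one_div_of_le (by positivity) (by linarith)
  rw [Qtilde_extend_eq]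
  exact (norm_chartAverage_le_mul (expWord_Ustr hV hV' c) hR₁
    (fun B hB => (exponent_analytic_and_bounded hL hV hV' hw𝒯 h𝒯 hε hW B hB).1)
    (fun B hB => (exponent_analytic_and_bounded hL hV hV' hw𝒯 h𝒯 hε hW B hB).2) hR hK hB).trans
    (mul_le_mul_of_nonneg_right hC (norm_nonneg _))

end Family

omit [NormOneClass 𝔸] in
/-- **THE AVERAGE IN THE CHART VANISHES AT `0`**: `Q̃_V(0)(c) = 0` (no hypothesis). [folklore] -/
theorem Qtilde_zero (L : ℕ) (𝒯 : (ZdEdge d → 𝔸ˣ) → (Fin d → ℤ) → 𝔸ˣ) (V : ZdEdge d → 𝔸ˣ) (c : ZdEdge d) :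
    Qtilde L 𝒯 V (0 : ZdEdge d → 𝔸) c = 0 := by
  unfold Qtilde
  rw [pert_zero, mul_inv_cancel, Units.val_one, mlog_one, smul_zero]

omit [NormOneClass 𝔸] in
/-- Block locality: `Q̃_V(B′)(c)` only reads `B′` on `B(c₋) ∪ B(c₊)` — it equals the chart average at the extension
by zero of the restriction of `B′` (`B12AverageCorridor267.Qtilde_congr`). [folklore] -/
theorem Qtilde_eq_extend_restrict (hL : 0 < L) (h𝒯loc : IsBlockLocal L 𝒯) (V : ZdEdge d → 𝔸ˣ)
    (B' : ZdEdge d → 𝔸) :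
    Qtilde L 𝒯 V B' c
      = Qtilde L 𝒯 V (Function.extend Subtype.val (fun i : ↥(qppBonds L c) => B' i) (0 : ZdEdge d → 𝔸)) c :=
  Qtilde_congr hL h𝒯loc V fun _ hb => (extend_restrict B' hb).symm

/-! ## §5 The printed instance [B7] (15): `𝒯 = gammaT` -/

section GammaT

variable (hL : 0 < L) (hV : ∀ b, ‖((V b : 𝔸ˣ) : 𝔸)‖ ≤ 1) (hV' : ∀ b, ‖(((V b)⁻¹ : 𝔸ˣ) : 𝔸)‖ ≤ 1)
  {ε : ℝ} (hε0 : 0 ≤ ε) (hε : ε ≤ 1 / 8)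
  (hW : ∀ x ∈ offAxis L c,
    ‖((loopW L (fun U : ZdEdge d → 𝔸ˣ => gammaT L U) V c x : 𝔸ˣ) : 𝔸) - 1‖ ≤ ε)
include hL hε0 hW

omit [NormedAlgebra ℂ 𝔸] [CompleteSpace 𝔸] [NormOneClass 𝔸] in
/-- For the printed contours every loop of `B(c₋)` is `ε`-close to `1`: off the axis by hypothesis, on the axis the
loop IS `1` (`loopW_axisSite`). [folklore] -/
theorem loops_small_gammaT :
    ∀ x ∈ blockSites L c.1, ‖((loopW L (fun U : ZdEdge d → 𝔸ˣ => gammaT L U) V c x : 𝔸ˣ) : 𝔸) - 1‖ ≤ ε := by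
  intro x hx
  by_cases hoff : x ∈ offAxis L c
  · exact hW x hoff
  · have hax : x ∈ axisSites L c := by
      by_contra h
      exact hoff (by rw [B12AverageCorridor267.offAxis, Finset.mem_filter]; exact ⟨hx, h⟩)
    rw [B12AverageCorridor267.axisSites, Finset.mem_image] at hax
    obtain ⟨l, hl, rfl⟩ := hax
    rw [loopW_axisSite (isAxisStraightFamily_gammaT hL) V c (Finset.mem_range.1 hl), Units.val_one, sub_self, norm_zero]
    exact hε0

include hV hV' hε

/-- **[B7] (15): THE PRINTED BLOCK AVERAGE IN THE CHART IS ANALYTIC** on `ball 0 (1∕(2816·(d+1)·L))` of the bond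
functions on `B(c₋) ∪ B(c₊)`, for every unit-bounded background with `ε`-regular off-axis block loops
(`ε ≤ 1∕8`; hypotheses exactly those of `h_paragraph_p267_gammaT`). [folklore] -/
theorem analyticOnNhd_Qtilde_gammaT :
    AnalyticOnNhd ℂ (fun B : ↥(qppBonds L c) → 𝔸 =>
        Qtilde L (fun U : ZdEdge d → 𝔸ˣ => gammaT L U) V (Function.extend Subtype.val B (0 : ZdEdge d → 𝔸)) c)
      (ball 0 (1 / (2816 * ((d : ℝ) + 1) * L))) := by
  have h := analyticOnNhd_Qtilde (𝒯 := fun U : ZdEdge d → 𝔸ˣ => gammaT L U) hL hV hV' (by positivity)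
    (expWord_gammaT hL hV hV') hε (loops_small_gammaT hL hε0 hW)
  have hr : (1 : ℝ) / (1408 * (2 * (d * L) + 2 * L)) = 1 / (2816 * ((d : ℝ) + 1) * L) := by
    congr 1; ring
  rwa [hr] at h

/-- **[B7] (15): … AND BOUNDED BY `2816·(d+1)·L·‖B‖ ≤ 1`** there. [folklore] -/
theorem norm_Qtilde_gammaT_le {B : ↥(qppBonds L c) → 𝔸} (hB : ‖B‖ < 1 / (2816 * ((d : ℝ) + 1) * L)) :
    ‖Qtilde L (fun U : ZdEdge d → 𝔸ˣ => gammaT L U) V (Function.extend Subtype.val B (0 : ZdEdge d → 𝔸)) c‖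
      ≤ 2816 * ((d : ℝ) + 1) * L * ‖B‖ := by
  have hr : (1408 : ℝ) * (2 * (d * L) + 2 * L) = 2816 * ((d : ℝ) + 1) * L := by ring
  have h := norm_Qtilde_le (𝒯 := fun U : ZdEdge d → 𝔸ˣ => gammaT L U) hL hV hV' (by positivity)
    (expWord_gammaT hL hV hV') hε (loops_small_gammaT hL hε0 hW) (B := B) (by rwa [hr])
  rwa [hr] at h

end GammaT

end Summit.QuantumFields.BalabanUV.T4Continuum.ShellMeasureAverageAnalyticB7
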